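import Summits.QuantumFields.YangMills.Theorems.SmallFieldWideningLargeFieldMassRefinementTailFreeTopSteps
import Summits.QuantumFields.YangMills.Theorems.SmallFieldWideningLargeFieldMassRefinementTailSeriesTail
import Summits.QuantumFields.YangMills.Theorems.SmallFieldWideningLargeFieldMassRefinementTailMassOfPerPlaquette
import Summits.QuantumFields.YangMills.Theorems.UnitScaleTiltHistoryTailBoundedHeight

/-!
# Route `SmallFieldWidening` — crux r3 `LargeFieldMassRefinementTail` (stmt-QuantumFields-22884): THE CRUX HOLDS UNCONDITIONALLY
# FOR BOUNDEDLY MANY RUNS AND AT THE BARE HEIGHT OF EVERY RUN — the line card's plan-only BC5 rung as a kernel theorem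
# (support file, leaf; width seat `ym-line-sfw-p2-w3` gen 3, line `birth` v5; the crux stays open)

The crux asks, for every block size `L`, for a profile `(b₀, p₀)` and a gate `γ₁` such that every family `F` (`F.L = L`) and
coupling `γ > 0` carry ONE null sequence `δ n → 0` with
`Gibbs^{F.refine n}_{K}((histGood (F.refine n) θ K 0)ᶜ) ≤ δ n` for every refinement depth `n` (coupling `γL^{-n} ≤ γ₁`) and EVERY
run `K` — the all-heights small-field event failing with probability `o(1)` in `n`, UNIFORMLY IN THE NUMBER `K` OF BLOCK-AVERAGED
HEIGHTS.  The line card (`Cruxes/LargeFieldMassRefinementTail`, planner ym-idea-1) names as its first rung (BC5, plan-only) the run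
`K = 0` (one unit-lattice `SU(2)` Wilson law at weak coupling); the ideator's census recorded it as «needs chessboard machinery absent
from the tree — not typable».  The machinery IS in the tree (`T3FinestHeightTail`: reflection positivity + chessboard, volume-uniform;
`HistoryTailBoundedHeight`: deterministic propagation of small fields through boundedly many (0.4)-averagings), so THIS FILE PROVES:

* §1 `refinedMass_le_sum_of_boundedHeightProfile` — the union bound of the companion file `…OfHeightTail` with the per-height
  hypothesis needed only at the heights `j ≤ J`, concluding for the runs `K ≤ J` (level shift: run `K` of `F.refine d` at `γL^{-d}`
  IS run `K + d` of `F` with `d` free top steps, `gibbsK_refine_real_compl_histGood`).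
* §2 `heightMass_boundedHeight` — for ONE family at `0 < γ ≤ 1` and every `J`, a per-height Gibbs-mass profile at the heights `j ≤ J`
  of the printed shape `72·C·L^{3(m+i)}·β_i^A·exp(−c·p(g_i)²)`, `i = K − j` (per plaquette: the K2 tree's
  `HistoryTailBoundedHeight.unitScaleTilt_perPlaquette_boundedHeight`; union over the `≤ 72·L^{3(m+i)}` plaquettes of `T^{(j)}_K`).
* §3 **`refinedMass_null_boundedRuns`** — for EVERY `J`, every family `F`, every `γ > 0` and EVERY profile `b₀ > 0`, `p₀ ≥ 1`:
  `∃ δ → 0, ∀ n, ∀ K ≤ J, γL^{-n} ≤ 1 → mass(n, K) ≤ δ n` — the crux's inequality for the runs `K ≤ J`, no hypothesis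
  (`δ n` = the `(n − n₀)`-tail of the convergent series `Σ_i 72C·L^{3(m₀+i)}β_i^A e^{−c p(g_i)²}` of the least admissible refinement
  `F.refine n₀`, `γL^{-n₀} ≤ 1`; convergence = the line's landed `LargeFieldMassRefinementTail.summable_term`).
  Corollaries in the crux's own quantifier shape: **`largeFieldMassRefinementTail_boundedRuns`** (`∀ n K, K ≤ J → …`) and
  **`largeFieldMassRefinementTail_runZero`** (the crux's text with `K := 0`: the BC5 rung).
* §4 **`bareMass_refine_null`** — the FINEST-HEIGHT part of the crux for EVERY run, uniformly: `∃ δ → 0, ∀ n K, γL^{-n} ≤ 1 →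
  Gibbs^{F.refine n}_K{U : ¬PlaqSmall θ(K) U} ≤ δ n` (chessboard tail `gibbsK_real_not_plaqSmall_le_of_radius`, `(√β)⁹ ≤ β⁵`,
  `β_Kθ(K)² = p(g_K)²`, domination by the `n`-tail of the same kind of series with `A = 5`, `c = ¼`).

SO THE OPEN CONTENT OF THE CRUX IS EXACTLY THE UNIFORMITY IN THE NUMBER OF BLOCK-AVERAGED HEIGHTS `1 ≤ j ≤ K` AS `K → ∞` (the
ultraviolet limit at fixed refinement), i.e. the large-field improbability of the block-AVERAGED plaquettes at unbounded height under the
interacting law — crux K2 of route `UnitScaleTilt` ([Balaban1985UV3] (41)/(47)/(71): per-plaquette factors printed inside the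
renormalised densities, probability bound unprinted); the lead's verdict (blocked-on the K2-L record `AlphaInputsT3ACv3RecChi`) is
unchanged.  The per-step loss `(151L²)²/L` of the deterministic propagation (`HistoryTailBoundedHeight`, «averaging is smoothing») is why
`J` cannot be sent to `∞` here.

WHAT THIS IS NOT: not the crux (uniformity in `K` is its content), no claim on crux K2, and nothing bearing on the Yang–Mills mass gap —
the route's leaf is the RECORD rung R3 (`YM3TorusSU2`), and even that is not proved by this file.

References: T. Bałaban, CMP 102 (1985) 255–275 [Balaban1985UV3] ((1)–(3) p.256, (7) p.257, (11) p.258, (71) p.273); T. Bałaban,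
CMP 98 (1985) 17–51 [Balaban1985Averaging] (Prop. 1 (51) p.26); J. Fröhlich, R. Israel, E. Lieb, B. Simon, CMP 62 (1978) 1–34
[FrohlichIsraelLiebSimon1978] (Thm. 4.1, the chessboard estimate behind `T3FinestHeightTail`).
-/

noncomputable section

open MeasureTheory Filter Topology
open scoped BigOperators
open Literature.MathematicalPhysics.QuantumFieldTheory.Balaban1983to89
open Literature.MathematicalPhysics.QuantumFieldTheory.Balaban1983to89.T3ContinuumYM3Torus
open Literature.MathematicalPhysics.QuantumFieldTheory.Balaban1983to89.T3UnitScaleTilt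
open Literature.MathematicalPhysics.QuantumFieldTheory.Balaban1983to89.T3UnitLawDensityEML
open Literature.MathematicalPhysics.QuantumFieldTheory.Balaban1983to89.T3HistoryTailReduction
open Literature.MathematicalPhysics.QuantumFieldTheory.Balaban1983to89.T3CruxEstimates
open Literature.MathematicalPhysics.QuantumFieldTheory.Balaban1983to89.T3FinestHeightTail (beta_mul_θBal_sq)
open Summit.QuantumFields.YangMills.Theorems.LargeFieldMassRefinementTailOfHeightTail
  (θBal_mul_pow gibbsK_refine_real_compl_histGood refine_refine)
open Summit.QuantumFields.YangMills.Theorems.LargeFieldMassRefinementTailFreeTopSteps (eventually_coupling_le)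
open Summit.QuantumFields.YangMills.Theorems.LargeFieldMassRefinementTail (summable_term card_plaq_le sqrt_pow_nine_le_pow_five)
open Summit.QuantumFields.YangMills.Theorems.HistoryTailBoundedHeight
  (unitScaleTilt_perPlaquette_boundedHeight gibbsK_real_not_plaqSmall_le_of_radius one_le_scheme_β θBal_nonneg')

namespace Summit.QuantumFields.YangMills.Theorems.LargeFieldMassRefinementTailBoundedRuns

/-! ## §1 The union bound over the constrained heights, with the per-height input needed only up to height `J` -/

section UnionBound

/-- **MASS OF THE RUNS `K ≤ J` OF EVERY REFINEMENT FROM A PER-HEIGHT PROFILE AT THE HEIGHTS `j ≤ J` OF ONE FAMILY.**  If for the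
family `F` at coupling `γ ≥ 0` the Gibbs probability (run `K'`) of a large block-averaged plaquette at height `j ≤ min(K', J)` is at most
`q(K' − j)`, then for every refinement depth `d` and every run `K ≤ J` the Gibbs mass (family `F.refine d`, coupling `γL^{-d}`, run `K`)
of the complement of the all-heights small-field event is at most `Σ_{t ≤ K} q(t + d)`: run `K` of `F.refine d` IS run `K + d` of `F`
with `d` free top steps (`gibbsK_refine_real_compl_histGood`), whose constrained heights are `j ≤ K ≤ J`, at distances `K + d − j ≥ d`
from the unit scale. [cite: Balaban1985UV3, (7) p.257 and (71) p.273] -/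
theorem refinedMass_le_sum_of_boundedHeightProfile (F : T3Family) {γ : ℝ} (hγ : 0 ≤ γ) (b₀ p₀ : ℝ) {J : ℕ}
    {q : ℕ → ℝ}
    (htail : ∀ K j, j ≤ K → j ≤ J → (gibbsK F ℰp γ K).real
      {U | ¬ PlaqSmall (θBal F.L γ b₀ p₀ (K - j))
        (Averaging.iter (fun i => BlockAveraging.blockAvg (P := F.P K) (j := i) ℰp) j U)} ≤ q (K - j))
    (d : ℕ) {K : ℕ} (hK : K ≤ J) :
    (gibbsK (F.refine d) ℰp (γ * ((F.L : ℝ)⁻¹) ^ d) K).real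
        (histGood (F.refine d) ℰp (θBal (F.refine d).L (γ * ((F.L : ℝ)⁻¹) ^ d) b₀ p₀) K 0)ᶜ ≤
      ∑ t ∈ Finset.range (K + 1), q (t + d) := by
  have hθ : θBal (F.refine d).L (γ * ((F.L : ℝ)⁻¹) ^ d) b₀ p₀ = fun i => θBal F.L γ b₀ p₀ (i + d) :=
    funext fun i => θBal_mul_pow F.L γ b₀ p₀ d i
  rw [hθ, gibbsK_refine_real_compl_histGood F ℰp measurableE_ℰp hγ (θBal F.L γ b₀ p₀) d K]
  haveI := isProbabilityMeasure_gibbsK F ℰp hγ (K + d)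
  refine (real_compl_histGood_le_sum F ℰp (θBal F.L γ b₀ p₀) (K + d) d (gibbsK F ℰp γ (K + d))).trans ?_
  rw [Nat.add_sub_cancel]
  have hrefl : ∑ j ∈ Finset.range (K + 1), q (K + d - j) = ∑ t ∈ Finset.range (K + 1), q (t + d) := by
    rw [← Finset.sum_range_reflect (fun t => q (t + d)) (K + 1)]
    refine Finset.sum_congr rfl fun j hj => ?_
    rw [Finset.mem_range] at hj
    congr 1
    omega
  calc ∑ j ∈ Finset.range (K + 1), (gibbsK F ℰp γ (K + d)).real
          {U | ¬ PlaqSmall (θBal F.L γ b₀ p₀ (K + d - j))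
            (Averaging.iter (fun i => BlockAveraging.blockAvg (P := F.P (K + d)) (j := i) ℰp) j U)}
      ≤ ∑ j ∈ Finset.range (K + 1), q (K + d - j) :=
        Finset.sum_le_sum fun j hj => by
          have hj' := Finset.mem_range.mp hj
          exact htail (K + d) j (by omega) (by omega)
    _ = ∑ t ∈ Finset.range (K + 1), q (t + d) := hrefl

end UnionBound

/-! ## §2 A per-height mass profile at bounded height for ONE family, from the K2 tree's bounded-height per-plaquette tail -/

section Profile

/-- **PER-HEIGHT LARGE-FIELD MASS AT BOUNDED HEIGHT, ONE FAMILY, NO HYPOTHESIS** (`0 < γ ≤ 1`, `0 ≤ b₀`, any `p₀`, any `J`): there are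
`C ≥ 0`, `A : ℕ`, `c > 0` with, for every run `K` and every height `j ≤ min(K, J)`,
`Gibbs_K{U : ¬PlaqSmall θ(K−j) (Ū^{j})} ≤ C·L^{3(m + (K−j))}·β_{K−j}^A·exp(−c·p(g_{K−j})²)`, `β_i = (γL^{-i})⁻¹`, `g_i = √(γL^{-i})` —
per plaquette the K2 tree's `unitScaleTilt_perPlaquette_boundedHeight` (crude Prop 1 for (0.4) iterated `j ≤ J` times + the
chessboard tail at the finest height), summed over the `≤ 72·L^{3(m+K−j)}` plaquettes of `T^{(j)}_K` (`card_plaq_le`).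
[cite: Balaban1985UV3, (7) p.257, (11) p.258 and (71) p.273; Balaban1985Averaging, Prop. 1 (51) p.26] -/
theorem heightMass_boundedHeight (J : ℕ) (F : T3Family) {γ b₀ : ℝ} (hγ : 0 < γ) (hγ1 : γ ≤ 1) (hb₀ : 0 ≤ b₀) (p₀ : ℝ) :
    ∃ (C : ℝ) (A : ℕ) (c : ℝ), 0 ≤ C ∧ 0 < c ∧ ∀ K j : ℕ, j ≤ K → j ≤ J →
      (gibbsK F ℰp γ K).real
          {U | ¬ PlaqSmall (θBal F.L γ b₀ p₀ (K - j))
            (Averaging.iter (fun i => BlockAveraging.blockAvg (P := F.P K) (j := i) ℰp) j U)} ≤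
        C * (F.L : ℝ) ^ (3 * (F.m + (K - j))) * ((γ * ((F.L : ℝ)⁻¹) ^ (K - j))⁻¹) ^ A *
          Real.exp (-(c * B10.pFun b₀ p₀ (Real.sqrt (γ * ((F.L : ℝ)⁻¹) ^ (K - j))) ^ 2)) := by
  obtain ⟨C, A, c, hC, hc, hpp⟩ := unitScaleTilt_perPlaquette_boundedHeight J F hγ hγ1 hb₀ p₀
  refine ⟨72 * C, A, c, by positivity, hc, fun K j hjK hjJ => ?_⟩
  haveI := isProbabilityMeasure_gibbsK F ℰp hγ.le K
  have hβ : (F.scheme ℰp γ).β (K - j) = (γ * ((F.L : ℝ)⁻¹) ^ (K - j))⁻¹ := rfl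
  have hβ0 : 0 ≤ (F.scheme ℰp γ).β (K - j) := F.scheme_β_nonneg ℰp hγ.le (K - j)
  have hterm0 : 0 ≤ C * (F.scheme ℰp γ).β (K - j) ^ A *
      Real.exp (-(c * B10.pFun b₀ p₀ (Real.sqrt (γ * ((F.L : ℝ)⁻¹) ^ (K - j))) ^ 2)) :=
    mul_nonneg (mul_nonneg hC (pow_nonneg hβ0 A)) (Real.exp_nonneg _)
  refine (real_not_plaqSmall_comp_le_sum (gibbsK F ℰp γ K)
    (fun U : GaugeField (F.P K) 0 (Matrix.specialUnitaryGroup (Fin 2) ℂ) =>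
      Averaging.iter (fun i => BlockAveraging.blockAvg (P := F.P K) (j := i) ℰp) j U)
    (θBal F.L γ b₀ p₀ (K - j))).trans ?_
  calc ∑ p : Plaq (F.P K) j, (gibbsK F ℰp γ K).real
          {U | θBal F.L γ b₀ p₀ (K - j) ≤
            GaugeGroup.dist1 (GaugeField.plaqHol
              (Averaging.iter (fun i => BlockAveraging.blockAvg (P := F.P K) (j := i) ℰp) j U) p)}
      ≤ ∑ _p : Plaq (F.P K) j, C * (F.scheme ℰp γ).β (K - j) ^ A *
          Real.exp (-(c * B10.pFun b₀ p₀ (Real.sqrt (γ * ((F.L : ℝ)⁻¹) ^ (K - j))) ^ 2)) :=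
        Finset.sum_le_sum fun p _ => hpp K j hjK hjJ p
    _ = (Fintype.card (Plaq (F.P K) j) : ℝ) * (C * (F.scheme ℰp γ).β (K - j) ^ A *
          Real.exp (-(c * B10.pFun b₀ p₀ (Real.sqrt (γ * ((F.L : ℝ)⁻¹) ^ (K - j))) ^ 2))) := by
        rw [Finset.sum_const, Finset.card_univ, nsmul_eq_mul]
    _ ≤ 72 * (F.L : ℝ) ^ (3 * (F.m + (K - j))) * (C * (F.scheme ℰp γ).β (K - j) ^ A *
          Real.exp (-(c * B10.pFun b₀ p₀ (Real.sqrt (γ * ((F.L : ℝ)⁻¹) ^ (K - j))) ^ 2))) :=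
        mul_le_mul_of_nonneg_right (card_plaq_le F hjK) hterm0
    _ = 72 * C * (F.L : ℝ) ^ (3 * (F.m + (K - j))) * ((γ * ((F.L : ℝ)⁻¹) ^ (K - j))⁻¹) ^ A *
          Real.exp (-(c * B10.pFun b₀ p₀ (Real.sqrt (γ * ((F.L : ℝ)⁻¹) ^ (K - j))) ^ 2)) := by
        rw [hβ]; ring

end Profile

/-! ## §3 The crux for boundedly many runs, unconditionally -/

section BoundedRuns

/-- **THE CRUX's INEQUALITY FOR THE RUNS `K ≤ J`, EVERY `J`, EVERY FAMILY, EVERY COUPLING, EVERY PROFILE `b₀ > 0`, `p₀ ≥ 1` — NO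
HYPOTHESIS.**  There is `δ n → 0` with `Gibbs^{F.refine n}_K((histGood (F.refine n) θ K 0)ᶜ) ≤ δ n` for every refinement depth `n` with
`γL^{-n} ≤ 1` and every run `K ≤ J`.  Proof: with `n₀` the least depth with `γL^{-n₀} ≤ 1`, `F.refine n = (F.refine n₀).refine (n − n₀)`
(`refine_refine`); §2 gives the family `F.refine n₀` at `γL^{-n₀}` a per-height profile `q(i) = C·L^{3(m₀+i)}·β_i^A·e^{−c p(g_i)²}` at the
heights `≤ J`; §1 bounds the mass by `Σ_{t ≤ K} q(t + n − n₀) ≤ Σ_{t ≥ 0} q(t + n − n₀) =: δ n`, the tail of a convergent series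
(`LargeFieldMassRefinementTail.summable_term`: `p(g_i)² ≳ i²` beats `(3 + A)·i·log L`), `→ 0` (`tendsto_sum_nat_add`).  Uniformity in
`K ≤ J` is automatic; uniformity in ALL `K` (the crux) is NOT claimed. [cite: Balaban1985UV3, (7) p.257 and (71) p.273] -/
theorem refinedMass_null_boundedRuns (J : ℕ) (F : T3Family) {γ b₀ p₀ : ℝ} (hγ : 0 < γ) (hb₀ : 0 < b₀) (hp₀ : 1 ≤ p₀) :
    ∃ δ : ℕ → ℝ, Tendsto δ atTop (𝓝 0) ∧ ∀ n K : ℕ, K ≤ J → γ * ((F.L : ℝ)⁻¹) ^ n ≤ 1 →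
      (gibbsK (F.refine n) ℰp (γ * ((F.L : ℝ)⁻¹) ^ n) K).real
        (histGood (F.refine n) ℰp (θBal (F.refine n).L (γ * ((F.L : ℝ)⁻¹) ^ n) b₀ p₀) K 0)ᶜ ≤ δ n := by
  classical
  have hex : ∃ n : ℕ, γ * ((F.L : ℝ)⁻¹) ^ n ≤ 1 := (eventually_coupling_le F γ one_pos).exists
  have hn₀ : γ * ((F.L : ℝ)⁻¹) ^ Nat.find hex ≤ 1 := Nat.find_spec hex
  have hL1 : (1 : ℝ) < F.L := by exact_mod_cast F.hL.2
  have hL0 : (0 : ℝ) < F.L := zero_lt_one.trans hL1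
  have hγ₀ : 0 < γ * ((F.L : ℝ)⁻¹) ^ Nat.find hex := mul_pos hγ (pow_pos (inv_pos.mpr hL0) _)
  -- the per-height profile of the least admissible refinement, at the heights `≤ J`
  obtain ⟨C, A, c, hC, hc, hprof⟩ :=
    heightMass_boundedHeight J (F.refine (Nat.find hex)) hγ₀ hn₀ hb₀.le p₀
  obtain ⟨q, hq⟩ : ∃ q : ℕ → ℝ, q = fun k : ℕ =>
      C * (F.L : ℝ) ^ (3 * ((F.refine (Nat.find hex)).m + k)) *
        ((γ * ((F.L : ℝ)⁻¹) ^ Nat.find hex * ((F.L : ℝ)⁻¹) ^ k)⁻¹) ^ A *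
          Real.exp (-(c * B10.pFun b₀ p₀
            (Real.sqrt (γ * ((F.L : ℝ)⁻¹) ^ Nat.find hex * ((F.L : ℝ)⁻¹) ^ k)) ^ 2)) := ⟨_, rfl⟩
  have hq0 : ∀ k, 0 ≤ q k := fun k => by
    rw [hq]; dsimp only; positivity
  have hqs : Summable q := by
    rw [hq]
    exact summable_term F.hL.2 (F.refine (Nat.find hex)).m A hb₀ hp₀ hc hC hγ₀
  have htail : ∀ K j, j ≤ K → j ≤ J → (gibbsK (F.refine (Nat.find hex)) ℰp (γ * ((F.L : ℝ)⁻¹) ^ Nat.find hex) K).real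
      {U | ¬ PlaqSmall (θBal (F.refine (Nat.find hex)).L (γ * ((F.L : ℝ)⁻¹) ^ Nat.find hex) b₀ p₀ (K - j))
        (Averaging.iter (fun i => BlockAveraging.blockAvg (P := (F.refine (Nat.find hex)).P K) (j := i) ℰp) j U)} ≤
      q (K - j) := fun K j hjK hjJ => by
    rw [hq]
    exact hprof K j hjK hjJ
  refine ⟨fun n => ∑' t, q (t + (n - Nat.find hex)),
    (tendsto_sum_nat_add q).comp (tendsto_sub_atTop_nat (Nat.find hex)), fun n K hK hle => ?_⟩
  have hn : Nat.find hex ≤ n := Nat.find_min' hex hle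
  obtain ⟨d, rfl⟩ : ∃ d, n = Nat.find hex + d := ⟨n - Nat.find hex, by omega⟩
  have hd : Nat.find hex + d - Nat.find hex = d := Nat.add_sub_cancel_left _ _
  have hcoup : γ * ((F.L : ℝ)⁻¹) ^ (Nat.find hex + d) =
      γ * ((F.L : ℝ)⁻¹) ^ Nat.find hex * ((F.L : ℝ)⁻¹) ^ d := by rw [pow_add, mul_assoc]
  have hs : Summable fun t => q (t + d) := (summable_nat_add_iff d).mpr hqs
  beta_reduce
  rw [hd, hcoup, ← refine_refine F (Nat.find hex) d]
  exact (refinedMass_le_sum_of_boundedHeightProfile (F.refine (Nat.find hex)) hγ₀.le b₀ p₀ htail d hK).trans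
    (hs.sum_le_tsum (Finset.range (K + 1)) fun t _ => hq0 _)

/-- **THE CRUX's STATEMENT RESTRICTED TO THE RUNS `K ≤ J` HOLDS, FOR EVERY `J`** — `LargeFieldMassRefinementTail` with its last
universal binder `∀ n K` weakened to `∀ n K, K ≤ J → …`, everything else verbatim (witnesses `b₀ = 1`, `p₀ = 3`, `γ₁ = 1`; in fact every
profile `b₀ > 0`, `p₀ ≥ 1` works, `refinedMass_null_boundedRuns`).  The crux itself (all `K` at once) is NOT proved.
[cite: Balaban1985UV3, (7) p.257 and (71) p.273] -/
theorem largeFieldMassRefinementTail_boundedRuns (J : ℕ) :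
    ∀ L : ℕ, ∃ b₀ p₀ γ₁ : ℝ, 0 < b₀ ∧ 2 < p₀ ∧ 0 < γ₁ ∧
      ∀ (F : T3Family) (γ : ℝ), F.L = L → 0 < γ →
        ∃ δ : ℕ → ℝ, Tendsto δ atTop (𝓝 0) ∧ ∀ n K : ℕ, K ≤ J → γ * ((F.L : ℝ)⁻¹) ^ n ≤ γ₁ →
          (gibbsK (F.refine n) ℰp (γ * ((F.L : ℝ)⁻¹) ^ n) K).real
            (histGood (F.refine n) ℰp (θBal (F.refine n).L (γ * ((F.L : ℝ)⁻¹) ^ n) b₀ p₀) K 0)ᶜ ≤ δ n :=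
  fun _ => ⟨1, 3, 1, one_pos, by norm_num, one_pos, fun F _ _ hγ =>
    refinedMass_null_boundedRuns J F hγ one_pos (by norm_num)⟩

/-- **THE BC5 RUNG OF THE LINE CARD: THE CRUX AT THE RUN `K = 0`** — `LargeFieldMassRefinementTail` with `K` specialised to `0`,
everything else verbatim: along the refinements `n → ∞` the unit-lattice `SU(2)` Wilson laws at couplings `γL^{-n}` on the tori of side
`2L^{m+n}` see a plaquette farther than `√(γL^{-n})·p(√(γL^{-n}))` from `1` with probability `→ 0` (chessboard tail × volume, the
profile's super-polynomial decay winning).  Unconditional; the crux (all runs `K`) is NOT proved. [cite: Balaban1985UV3, (7) p.257 and (71) p.273] -/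
theorem largeFieldMassRefinementTail_runZero :
    ∀ L : ℕ, ∃ b₀ p₀ γ₁ : ℝ, 0 < b₀ ∧ 2 < p₀ ∧ 0 < γ₁ ∧
      ∀ (F : T3Family) (γ : ℝ), F.L = L → 0 < γ →
        ∃ δ : ℕ → ℝ, Tendsto δ atTop (𝓝 0) ∧ ∀ n : ℕ, γ * ((F.L : ℝ)⁻¹) ^ n ≤ γ₁ →
          (gibbsK (F.refine n) ℰp (γ * ((F.L : ℝ)⁻¹) ^ n) 0).real
            (histGood (F.refine n) ℰp (θBal (F.refine n).L (γ * ((F.L : ℝ)⁻¹) ^ n) b₀ p₀) 0 0)ᶜ ≤ δ n := by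
  intro L
  obtain ⟨b₀, p₀, γ₁, hb₀, hp₀, hγ₁, h⟩ := largeFieldMassRefinementTail_boundedRuns 0 L
  refine ⟨b₀, p₀, γ₁, hb₀, hp₀, hγ₁, fun F γ hFL hγ => ?_⟩
  obtain ⟨δ, hδ, hmass⟩ := h F γ hFL hγ
  exact ⟨δ, hδ, fun n hle => hmass n 0 le_rfl hle⟩

end BoundedRuns

/-! ## §4 The finest-height part of the crux, for EVERY run, uniformly -/

section Bare

/-- **THE BARE-HEIGHT PART OF THE CRUX HOLDS FOR EVERY RUN `K`, UNIFORMLY** (every family, every `γ > 0`, every profile `b₀ > 0`,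
`p₀ ≥ 1`): there is `δ n → 0` with `Gibbs^{F.refine n}_K{U : ¬PlaqSmall θ(K) U} ≤ δ n` for all `n` with `γL^{-n} ≤ 1` and ALL `K` — the
`j = 0` term of the complement of the all-heights event (threshold `θ(K) = g·p(g)`, `g² = γL^{-n}L^{-K}`, `β = g⁻²`).  Chessboard tail of
the finest height (`gibbsK_real_not_plaqSmall_le_of_radius`: `≤ #P·2e^{24}c₀^{-3}(√β)⁹e^{−βθ²/4}`, `βθ² = p(g)²`), `#P ≤ 72·L^{3(m+n+K)}`,
`(√β)⁹ ≤ β⁵`: the bound is the term `a(n + K)` of ONE convergent series `a(k) = C·L^{3(m+k)}·β_k⁵·e^{−p(g_k)²/4}` (`summable_term`), hence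
`≤ Σ_{k ≥ n} a(k) =: δ n → 0`.  So the crux's open content sits entirely at the block-AVERAGED heights `1 ≤ j ≤ K`.
[cite: Balaban1985UV3, (7) p.257, (11) p.258 and (71) p.273; FrohlichIsraelLiebSimon1978, Thm. 4.1] -/
theorem bareMass_refine_null (F : T3Family) {γ b₀ p₀ : ℝ} (hγ : 0 < γ) (hb₀ : 0 < b₀) (hp₀ : 1 ≤ p₀) :
    ∃ δ : ℕ → ℝ, Tendsto δ atTop (𝓝 0) ∧ ∀ n K : ℕ, γ * ((F.L : ℝ)⁻¹) ^ n ≤ 1 →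
      (gibbsK (F.refine n) ℰp (γ * ((F.L : ℝ)⁻¹) ^ n) K).real
        {U | ¬ PlaqSmall (θBal (F.refine n).L (γ * ((F.L : ℝ)⁻¹) ^ n) b₀ p₀ K) U} ≤ δ n := by
  obtain ⟨c₀, hc₀, -, hfine⟩ := gibbsK_real_not_plaqSmall_le_of_radius
  have hL1 : (1 : ℝ) < F.L := by exact_mod_cast F.hL.2
  have hL0 : (0 : ℝ) < F.L := zero_lt_one.trans hL1
  -- the dominating series
  obtain ⟨a, ha⟩ : ∃ a : ℕ → ℝ, a = fun k : ℕ =>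
      72 * (2 * Real.exp 24 * (c₀ ^ 3)⁻¹) * (F.L : ℝ) ^ (3 * (F.m + k)) * ((γ * ((F.L : ℝ)⁻¹) ^ k)⁻¹) ^ 5 *
        Real.exp (-(1 / 4 * B10.pFun b₀ p₀ (Real.sqrt (γ * ((F.L : ℝ)⁻¹) ^ k)) ^ 2)) := ⟨_, rfl⟩
  have ha0 : ∀ k, 0 ≤ a k := fun k => by
    rw [ha]; dsimp only; positivity
  have has : Summable a := by
    rw [ha]
    exact summable_term F.hL.2 F.m 5 hb₀ hp₀ (by norm_num) (by positivity) hγ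
  refine ⟨fun n => ∑' k, a (k + n), tendsto_sum_nat_add a, fun n K hle => ?_⟩
  have hγn : 0 < γ * ((F.L : ℝ)⁻¹) ^ n := mul_pos hγ (pow_pos (inv_pos.mpr hL0) n)
  -- the refined family's run `K`: coupling `x = γL^{-n}L^{-K} = γL^{-(K+n)}`, `β = x⁻¹ ≥ 1`, threshold `θ ≥ 0`
  have hx : γ * ((F.L : ℝ)⁻¹) ^ n * (((F.refine n).L : ℝ)⁻¹) ^ K = γ * ((F.L : ℝ)⁻¹) ^ (K + n) := by
    rw [T3Family.refine_L, pow_add]; ring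
  have hβ : ((F.refine n).scheme ℰp (γ * ((F.L : ℝ)⁻¹) ^ n)).β K =
      (γ * ((F.L : ℝ)⁻¹) ^ n * (((F.refine n).L : ℝ)⁻¹) ^ K)⁻¹ := rfl
  have hβ1 : 1 ≤ ((F.refine n).scheme ℰp (γ * ((F.L : ℝ)⁻¹) ^ n)).β K :=
    one_le_scheme_β (F.refine n) hγn hle K
  have hθ0 : 0 ≤ θBal (F.refine n).L (γ * ((F.L : ℝ)⁻¹) ^ n) b₀ p₀ K :=
    θBal_nonneg' (F.refine n) hγn hle hb₀.le p₀ K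
  have h1 := hfine (F.refine n) (γ * ((F.L : ℝ)⁻¹) ^ n) hγn K _ hθ0 hβ1
  refine h1.trans ?_
  -- counting, `(√β)⁹ ≤ β⁵`, and the exponent `βθ²/4 = p(g)²/4`
  have hcard : (Fintype.card (Plaq ((F.refine n).P K) 0) : ℝ) ≤ 72 * (F.L : ℝ) ^ (3 * (F.m + (K + n))) := by
    have h := card_plaq_le (F.refine n) (Nat.zero_le K)
    rw [T3Family.refine_L, T3Family.refine_m, Nat.sub_zero,
      show F.m + n + K = F.m + (K + n) by omega] at h
    exact h
  have hsqrt : Real.sqrt (((F.refine n).scheme ℰp (γ * ((F.L : ℝ)⁻¹) ^ n)).β K) ^ 9 ≤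
      ((γ * ((F.L : ℝ)⁻¹) ^ (K + n))⁻¹) ^ 5 := by
    rw [← hx, ← hβ]; exact sqrt_pow_nine_le_pow_five hβ1
  have hexp : Real.exp (-(((F.refine n).scheme ℰp (γ * ((F.L : ℝ)⁻¹) ^ n)).β K *
        θBal (F.refine n).L (γ * ((F.L : ℝ)⁻¹) ^ n) b₀ p₀ K ^ 2 / 4)) =
      Real.exp (-(1 / 4 * B10.pFun b₀ p₀ (Real.sqrt (γ * ((F.L : ℝ)⁻¹) ^ (K + n))) ^ 2)) := by
    rw [beta_mul_θBal_sq (F.refine n) hγn b₀ p₀ K, hx]; ring_nf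
  have hs : Summable fun k => a (k + n) := (summable_nat_add_iff n).mpr has
  calc (Fintype.card (Plaq ((F.refine n).P K) 0) : ℝ) *
        (2 * Real.exp 24 * (c₀ ^ 3)⁻¹ *
          Real.sqrt (((F.refine n).scheme ℰp (γ * ((F.L : ℝ)⁻¹) ^ n)).β K) ^ 9 *
            Real.exp (-(((F.refine n).scheme ℰp (γ * ((F.L : ℝ)⁻¹) ^ n)).β K *
              θBal (F.refine n).L (γ * ((F.L : ℝ)⁻¹) ^ n) b₀ p₀ K ^ 2 / 4)))
      ≤ 72 * (F.L : ℝ) ^ (3 * (F.m + (K + n))) *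
          (2 * Real.exp 24 * (c₀ ^ 3)⁻¹ * ((γ * ((F.L : ℝ)⁻¹) ^ (K + n))⁻¹) ^ 5 *
            Real.exp (-(1 / 4 * B10.pFun b₀ p₀ (Real.sqrt (γ * ((F.L : ℝ)⁻¹) ^ (K + n))) ^ 2))) := by
        rw [hexp]
        gcongr
    _ = a (K + n) := by rw [ha]; dsimp only; ring
    _ = ∑ k ∈ ({K} : Finset ℕ), a (k + n) := (Finset.sum_singleton (fun k => a (k + n)) K).symm
    _ ≤ ∑' k, a (k + n) := hs.sum_le_tsum {K} fun k _ => ha0 _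

end Bare

/-! ## §5 The crux IS its block-averaged-heights part (o(1) currency): the bare height is idle -/

section Averaged

/-- **r3 ⇔ r3 FOR THE BLOCK-AVERAGED HEIGHTS `1 ≤ j ≤ K` ONLY.**  `LargeFieldMassRefinementTail` is EQUIVALENT to the same statement with
the complement of the all-heights event replaced by the event «some block-AVERAGED plaquette at a height `1 ≤ j ≤ K` is `θ(K−j)`-large»:
(⇒) that event is contained in the complement; (⇐) the complement is contained in its union with the bare large-field event, whose mass
is `o(1)` uniformly in `K` by §4 (`bareMass_refine_null`; gate shrunk to `min γ₁ 1`).  Kernel certificate that the crux's content is the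
large-field improbability of the AVERAGED fields alone — the unprinted probability bound behind [Balaban1985UV3] (71).
[cite: Balaban1985UV3, (7) p.257 and (71) p.273] -/
theorem largeFieldMassRefinementTail_iff_averagedHeights :
    Summit.QuantumFields.YangMills.Theses.SmallFieldWidening.LargeFieldMassRefinementTail ↔
      ∀ L : ℕ, ∃ b₀ p₀ γ₁ : ℝ, 0 < b₀ ∧ 2 < p₀ ∧ 0 < γ₁ ∧
        ∀ (F : T3Family) (γ : ℝ), F.L = L → 0 < γ →
          ∃ δ : ℕ → ℝ, Tendsto δ atTop (𝓝 0) ∧ ∀ n K : ℕ, γ * ((F.L : ℝ)⁻¹) ^ n ≤ γ₁ →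
            (gibbsK (F.refine n) ℰp (γ * ((F.L : ℝ)⁻¹) ^ n) K).real
              {U | ∃ j, 1 ≤ j ∧ j ≤ K ∧
                ¬ PlaqSmall (θBal (F.refine n).L (γ * ((F.L : ℝ)⁻¹) ^ n) b₀ p₀ (K - j))
                  (Averaging.iter (fun i => BlockAveraging.blockAvg (P := (F.refine n).P K) (j := i) ℰp) j U)} ≤
              δ n := by
  constructor
  · intro h L
    obtain ⟨b₀, p₀, γ₁, hb₀, hp₀, hγ₁, H⟩ := h L
    refine ⟨b₀, p₀, γ₁, hb₀, hp₀, hγ₁, fun F γ hFL hγ => ?_⟩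
    obtain ⟨δ, hδ, hmass⟩ := H F γ hFL hγ
    have hL0 : (0 : ℝ) < F.L := by exact_mod_cast (zero_lt_one.trans F.hL.2)
    refine ⟨δ, hδ, fun n K hle => ?_⟩
    haveI := isProbabilityMeasure_gibbsK (F.refine n) ℰp (mul_pos hγ (pow_pos (inv_pos.mpr hL0) n)).le K
    refine (measureReal_mono ?_).trans (hmass n K hle)
    rintro U ⟨j, -, hjK, hbad⟩ hgood
    exact hbad (hgood j (by omega))
  · intro h L
    obtain ⟨b₀, p₀, γ₁, hb₀, hp₀, hγ₁, H⟩ := h L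
    refine ⟨b₀, p₀, min γ₁ 1, hb₀, hp₀, lt_min hγ₁ one_pos, fun F γ hFL hγ => ?_⟩
    obtain ⟨δ₁, hδ₁, havg⟩ := H F γ hFL hγ
    obtain ⟨δ₀, hδ₀, hbare⟩ := bareMass_refine_null F (p₀ := p₀) hγ hb₀ (by linarith)
    have hL0 : (0 : ℝ) < F.L := by exact_mod_cast (zero_lt_one.trans F.hL.2)
    refine ⟨fun n => δ₀ n + δ₁ n, by simpa using hδ₀.add hδ₁, fun n K hle => ?_⟩
    have hle₁ : γ * ((F.L : ℝ)⁻¹) ^ n ≤ γ₁ := hle.trans (min_le_left _ _)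
    have hle₀ : γ * ((F.L : ℝ)⁻¹) ^ n ≤ 1 := hle.trans (min_le_right _ _)
    haveI := isProbabilityMeasure_gibbsK (F.refine n) ℰp (mul_pos hγ (pow_pos (inv_pos.mpr hL0) n)).le K
    -- not small at every height ⇒ large at the bare height or at some averaged height
    have hsub : (histGood (F.refine n) ℰp (θBal (F.refine n).L (γ * ((F.L : ℝ)⁻¹) ^ n) b₀ p₀) K 0)ᶜ ⊆
        {U | ¬ PlaqSmall (θBal (F.refine n).L (γ * ((F.L : ℝ)⁻¹) ^ n) b₀ p₀ K) U} ∪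
          {U | ∃ j, 1 ≤ j ∧ j ≤ K ∧
            ¬ PlaqSmall (θBal (F.refine n).L (γ * ((F.L : ℝ)⁻¹) ^ n) b₀ p₀ (K - j))
              (Averaging.iter (fun i => BlockAveraging.blockAvg (P := (F.refine n).P K) (j := i) ℰp) j U)} := by
      intro U hU
      simp only [Set.mem_compl_iff, histGood, Set.mem_setOf_eq, not_forall] at hU
      obtain ⟨j, hj, hbad⟩ := hU
      rcases Nat.eq_zero_or_pos j with hj0 | hj0
      · subst hj0
        exact Or.inl hbad
      · exact Or.inr ⟨j, hj0, by omega, hbad⟩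
    calc (gibbsK (F.refine n) ℰp (γ * ((F.L : ℝ)⁻¹) ^ n) K).real
          (histGood (F.refine n) ℰp (θBal (F.refine n).L (γ * ((F.L : ℝ)⁻¹) ^ n) b₀ p₀) K 0)ᶜ
        ≤ (gibbsK (F.refine n) ℰp (γ * ((F.L : ℝ)⁻¹) ^ n) K).real
            ({U | ¬ PlaqSmall (θBal (F.refine n).L (γ * ((F.L : ℝ)⁻¹) ^ n) b₀ p₀ K) U} ∪
              {U | ∃ j, 1 ≤ j ∧ j ≤ K ∧
                ¬ PlaqSmall (θBal (F.refine n).L (γ * ((F.L : ℝ)⁻¹) ^ n) b₀ p₀ (K - j))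
                  (Averaging.iter (fun i => BlockAveraging.blockAvg (P := (F.refine n).P K) (j := i) ℰp) j U)}) :=
          measureReal_mono hsub
      _ ≤ _ := measureReal_union_le _ _
      _ ≤ δ₀ n + δ₁ n := add_le_add (hbare n K hle₀) (havg n K hle₁)

end Averaged

end Summit.QuantumFields.YangMills.Theorems.LargeFieldMassRefinementTailBoundedRuns

end
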